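import Mathlib
import Summits.MatrixMultiplication.MatrixMultiplication.Theorems.SnSubsetDichotomyHyperoctahedralThresholdWordCollisions

/-!
# Root census: the reduction `RootAtom → GoodCollisionWalk → stub_poorRigidCore` (STUB-PLAN T4)

Helper for crux `SnSubsetDichotomy.HyperoctahedralThreshold` (stmt-MatrixMultiplication-10883), line
`STUB-PLAN-stub_poorRigidCore` (root-local twin census with an absorbed forbidden set,
`Cruxes/HyperoctahedralThreshold/STUB-PLAN-stub_poorRigidCore.md` §2 T4).

`stub_rootCensus : RootAtom → GoodCollisionWalk → Stub` with all three bodies unfolded (the registered stubs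
`stub_rootAtom`, `stub_goodCollisionWalk`, `stub_poorRigidCore` of the crux item).  Proof: the atom either hands over
the conclusion, or a root rung `(v, x)`, an absorbing set `F ⊇ R` and a depth `a` (`2a ≤ ⌊n^(1/4)⌋`) at which the
`F`-avoiding self-clean reduced words `Φ` satisfy `n²·(|Φ| + #Bad) < |Φ|²`; Cauchy–Schwarz on the endpoint map
`β ↦ (v·β, x·β) : Φ → Fin n × Fin n` (`SameColourSupply.card_sq_le_card_mul_collisions`) gives
`|Φ|² ≤ n²·(|Φ| + #Coll)`, so some colliding ordered pair of distinct members of `Φ` lies outside `Bad`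
(`exists_collision_not_mem`), i.e. is mutually clean; both members are self-clean and `F`-free, hence `R`-free, and
`GoodCollisionWalk` turns the pair into clean closed-rung-walk data with `k + 1 ≤ 2a ≤ n^(1/4)` rungs.
-/

-- the tree's namespace `Summit.MatrixMultiplication.MatrixMultiplication.…` repeats a component by design
set_option linter.dupNamespace false

namespace Summit.MatrixMultiplication.MatrixMultiplication.Theorems.HyperoctahedralThreshold

namespace RootCensus

open Finset

/-- **Collisions outnumber any set below the Cauchy–Schwarz floor.**  For a finset `X` mapped into `Fin n × Fin n`
by `a ↦ (f a, g a)` and ANY finset `B` of pairs with `n² · (|X| + |B|) < |X|²`, some ordered pair of distinct elements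
of `X` collides under `(f, g)` and lies outside `B` — because Cauchy–Schwarz gives
`|X|² ≤ n² · (|X| + #{colliding ordered pairs of distinct elements})`. [folklore] -/
theorem exists_collision_not_mem {α : Type*} [DecidableEq α] {n : ℕ} (X : Finset α) (f g : α → Fin n)
    (B : Finset (α × α)) (h : n ^ 2 * (X.card + B.card) < X.card ^ 2) :
    ∃ a ∈ X, ∃ b ∈ X, a ≠ b ∧ f a = f b ∧ g a = g b ∧ (a, b) ∉ B := by
  by_contra hno
  push Not at hno
  have hCS := SameColourSupply.card_sq_le_card_mul_collisions X
    ((univ : Finset (Fin n)) ×ˢ (univ : Finset (Fin n))) (fun a => (f a, g a)) (fun a _ => by simp)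
  rw [card_product, card_univ, Fintype.card_fin, ← sq] at hCS
  have hsub : (X ×ˢ X).filter (fun p => p.1 ≠ p.2 ∧ (f p.1, g p.1) = (f p.2, g p.2)) ⊆ B := by
    intro p hp
    rw [mem_filter, mem_product, Prod.mk.injEq] at hp
    obtain ⟨⟨h1, h2⟩, hne, hf, hg⟩ := hp
    exact hno p.1 h1 p.2 h2 hne hf hg
  have h' := hCS.trans (Nat.mul_le_mul_left _ (Nat.add_le_add_left (card_le_card hsub) _))
  exact absurd (lt_of_lt_of_le h h') (lt_irrefl _)

end RootCensus

open Finset RootCensus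

/-- **`stub_cleanCollisionExists`** (registered sub-goal of stmt-MatrixMultiplication-10883; the Cauchy–Schwarz core of
STUB-PLAN T4 in the tree's vocabulary): below the floor `n²·(|X| + |B|) < |X|²` some colliding ordered pair of distinct
words lies outside `B`. -/
theorem stub_cleanCollisionExists : ∀ (n : ℕ) (X : Finset (List (Fin 3))) (f g : List (Fin 3) → Fin n) (B : Finset (List (Fin 3) × List (Fin 3))), n ^ 2 * (X.card + B.card) < X.card ^ 2 → ∃ β ∈ X, ∃ β' ∈ X, β ≠ β' ∧ f β = f β' ∧ g β = g β' ∧ (β, β') ∉ B :=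
  fun _ X f g B h => exists_collision_not_mem X f g B h

/-- **Root census** (STUB-PLAN T4): `RootAtom → GoodCollisionWalk → stub_poorRigidCore`, bodies unfolded.
See the module docstring for the proof. -/
theorem stub_rootCensus : (∃ n₀ : ℕ, ∀ n ≥ n₀, ∀ μ : Fin 3 → Equiv.Perm (Fin n), (∀ i, μ i * μ i = 1 ∧ ∀ v, μ i v ≠ v) → ∀ R : Finset (Fin n), (R.card : ℝ) ≤ (n : ℝ) ^ ((3 : ℝ) / 4) → (∀ z : List (Fin 3), z ≠ [] → List.IsChain (· ≠ ·) (z ++ z) → (z.length : ℝ) ≤ (n : ℝ) ^ ((1 : ℝ) / 4) → ∀ (m : ℕ) (x : Fin m → Fin n), Function.Injective x → (∀ i, z.foldl (fun v c => μ c v) (x i) = x i) → m ≤ (4 * z.length ^ 2) ^ (Nat.log 2 z.length + 1) * (R.card + 1)) → (∀ z : List (Fin 3), z ≠ [] → List.IsChain (· ≠ ·) (z ++ z) → (z.length : ℝ) ≤ (n : ℝ) ^ ((1 : ℝ) / 4) → ∀ (m : ℕ) (x : Fin m → Fin n), Function.Injective x → (∀ i, z.foldl (fun v c => μ c v) (x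 i) = x i) → (∀ i j, ∀ s t : Fin z.length, ((z.take (s : ℕ)).foldl (fun v c => μ c v) (x i) = (z.take (t : ℕ)).foldl (fun v c => μ c v) (x i) ↔ (z.take (s : ℕ)).foldl (fun v c => μ c v) (x j) = (z.take (t : ℕ)).foldl (fun v c => μ c v) (x j))) → m ≤ 2 * (z.length * R.card) + z.length ^ 2 + 1) → (∃ (k : ℕ) (p q : Fin (k + 1) → Fin n) (col : Fin (k + 1) → Fin 3), (∀ i, p i ≠ q i) ∧ (∀ i, (μ (col i) (p i) = p (i + 1) ∧ μ (col i) (q i) = q (i + 1)) ∨ (μ (col i) (p i) = q (i + 1) ∧ μ (col i) (q i) = p (i + 1))) ∧ (∀ i, col i ≠ col (i + 1)) ∧ (∀ i j, (p i = p j ∧ q i = q j) ∨ (p i = q j ∧ q i = p j) ∨ (p i ≠ p j ∧ p i ≠ q j ∧ q i ≠ p j ∧ q i ≠ q j)) ∧ (∀ i, p i ∉ R ∧ q i ∉ R) ∧ ((k : ℝ) + 1) ≤ (n : ℝ) ^ ((1 : ℝ) / 4)) ∨ ∃ (F : Finset (Fin n)) (a : ℕ) (v x : Fin n), R ⊆ F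 ∧ v ≠ x ∧ 2 * a ≤ ⌊(n : ℝ) ^ ((1 : ℝ) / 4)⌋₊ ∧ (let Φ : Finset (List (Fin 3)) := (((Finset.univ : Finset (List.Vector (Fin 3) a)).image List.Vector.toList).filter (fun β => List.IsChain (· ≠ ·) β ∧ (∀ t ≤ a, (β.take t).foldl (fun w d => μ d w) v ∉ F ∧ (β.take t).foldl (fun w d => μ d w) x ∉ F) ∧ (∀ s ≤ a, ∀ t ≤ a, ((((β.take s).foldl (fun w d => μ d w) v) = ((β.take t).foldl (fun w d => μ d w) v) ∧ ((β.take s).foldl (fun w d => μ d w) x) = ((β.take t).foldl (fun w d => μ d w) x)) ∨ (((β.take s).foldl (fun w d => μ d w) v) = ((β.take t).foldl (fun w d => μ d w) x) ∧ ((β.take s).foldl (fun w d => μ d w) x) = ((β.take t).foldl (fun w d => μ d w) v)) ∨ (((β.take s).foldl (fun w d => μ d w) v) ≠ ((β.take t).foldl (fun w d => μ d w) v) ∧ ((β.take s).foldl (fun w d => μ d w) v) ≠ ((β.take t).foldl (fun w d => μ d w) x) ∧ ((β.take s).foldl (fun w d => μ d w) x) ≠ ((β.take t).foldl (fun w d =>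 μ d w) v) ∧ ((β.take s).foldl (fun w d => μ d w) x) ≠ ((β.take t).foldl (fun w d => μ d w) x)))))); n ^ 2 * (Φ.card + ((Φ ×ˢ Φ).filter (fun b => b.1 ≠ b.2 ∧ b.1.foldl (fun w d => μ d w) v = b.2.foldl (fun w d => μ d w) v ∧ b.1.foldl (fun w d => μ d w) x = b.2.foldl (fun w d => μ d w) x ∧ ¬ (∀ s ≤ a, ∀ t ≤ a, ((((b.1.take s).foldl (fun w d => μ d w) v) = ((b.2.take t).foldl (fun w d => μ d w) v) ∧ ((b.1.take s).foldl (fun w d => μ d w) x) = ((b.2.take t).foldl (fun w d => μ d w) x)) ∨ (((b.1.take s).foldl (fun w d => μ d w) v) = ((b.2.take t).foldl (fun w d => μ d w) x) ∧ ((b.1.take s).foldl (fun w d => μ d w) x) = ((b.2.take t).foldl (fun w d => μ d w) v)) ∨ (((b.1.take s).foldl (fun w d => μ d w) v) ≠ ((b.2.take t).foldl (fun w d => μ d w) v) ∧ ((b.1.take s).foldl (fun w d => μ d w) v) ≠ ((b.2.take t).foldl (fun w d => μ d w) x) ∧ ((b.1.take s).foldl (fun w d => μ d w) x) ≠ ((b.2.take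 t).foldl (fun w d => μ d w) v) ∧ ((b.1.take s).foldl (fun w d => μ d w) x) ≠ ((b.2.take t).foldl (fun w d => μ d w) x)))))).card) < Φ.card ^ 2)) → (∀ (n a : ℕ) (μ : Fin 3 → Equiv.Perm (Fin n)) (R : Finset (Fin n)) (v x : Fin n) (β β' : List (Fin 3)), (∀ b, μ b * μ b = 1) → v ≠ x → β.length = a → β'.length = a → β ≠ β' → List.IsChain (· ≠ ·) β → List.IsChain (· ≠ ·) β' → β.foldl (fun v b => μ b v) v = β'.foldl (fun v b => μ b v) v → β.foldl (fun v b => μ b v) x = β'.foldl (fun v b => μ b v) x → (∀ t ≤ a, (β.take t).foldl (fun v b => μ b v) v ∉ R ∧ (β.take t).foldl (fun v b => μ b v) x ∉ R ∧ (β'.take t).foldl (fun v b => μ b v) v ∉ R ∧ (β'.take t).foldl (fun v b => μ b v) x ∉ R) → (∀ γ γ' : List (Fin 3), (γ = β ∨ γ = β') → (γ' = β ∨ γ' = β') → ∀ s ≤ a, ∀ t ≤ a, ((γ.take s).foldl (fun v b => μ b v) v = (γ'.take t).foldl (fun v b => μ b v) v ∧ (γ.take s).foldl (fun v b => μ b v)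 x = (γ'.take t).foldl (fun v b => μ b v) x) ∨ ((γ.take s).foldl (fun v b => μ b v) v = (γ'.take t).foldl (fun v b => μ b v) x ∧ (γ.take s).foldl (fun v b => μ b v) x = (γ'.take t).foldl (fun v b => μ b v) v) ∨ ((γ.take s).foldl (fun v b => μ b v) v ≠ (γ'.take t).foldl (fun v b => μ b v) v ∧ (γ.take s).foldl (fun v b => μ b v) v ≠ (γ'.take t).foldl (fun v b => μ b v) x ∧ (γ.take s).foldl (fun v b => μ b v) x ≠ (γ'.take t).foldl (fun v b => μ b v) v ∧ (γ.take s).foldl (fun v b => μ b v) x ≠ (γ'.take t).foldl (fun v b => μ b v) x)) → ∃ (k : ℕ) (p q : Fin (k + 1) → Fin n) (col : Fin (k + 1) → Fin 3), (∀ i, p i ≠ q i) ∧ (∀ i, (μ (col i) (p i) = p (i + 1) ∧ μ (col i) (q i) = q (i + 1)) ∨ (μ (col i) (p i) = q (i + 1) ∧ μ (col i) (q i) = p (i + 1))) ∧ (∀ i, col i ≠ col (i + 1)) ∧ (∀ i j, (p i = p j ∧ q i = q j) ∨ (p i = q j ∧ q i = p j) ∨ (p i ≠ p j ∧ p i ≠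 q j ∧ q i ≠ p j ∧ q i ≠ q j)) ∧ (∀ i, p i ∉ R ∧ q i ∉ R) ∧ k + 1 ≤ 2 * a) → (∃ n₀ : ℕ, ∀ n ≥ n₀, ∀ μ : Fin 3 → Equiv.Perm (Fin n), (∀ i, μ i * μ i = 1 ∧ ∀ v, μ i v ≠ v) → ∀ R : Finset (Fin n), (R.card : ℝ) ≤ (n : ℝ) ^ ((3 : ℝ) / 4) → (∀ z : List (Fin 3), z ≠ [] → List.IsChain (· ≠ ·) (z ++ z) → (z.length : ℝ) ≤ (n : ℝ) ^ ((1 : ℝ) / 4) → ∀ (m : ℕ) (x : Fin m → Fin n), Function.Injective x → (∀ i, z.foldl (fun v c => μ c v) (x i) = x i) → m ≤ (4 * z.length ^ 2) ^ (Nat.log 2 z.length + 1) * (R.card + 1)) → (∀ z : List (Fin 3), z ≠ [] → List.IsChain (· ≠ ·) (z ++ z) → (z.length : ℝ) ≤ (n : ℝ) ^ ((1 : ℝ) / 4) → ∀ (m : ℕ) (x : Fin m → Fin n), Function.Injective x → (∀ i, z.foldl (fun v c => μ c v) (x i) = x i) → (∀ i j, ∀ s t : Fin z.length, ((z.take (s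 : ℕ)).foldl (fun v c => μ c v) (x i) = (z.take (t : ℕ)).foldl (fun v c => μ c v) (x i) ↔ (z.take (s : ℕ)).foldl (fun v c => μ c v) (x j) = (z.take (t : ℕ)).foldl (fun v c => μ c v) (x j))) → m ≤ 2 * (z.length * R.card) + z.length ^ 2 + 1) → ∃ (k : ℕ) (p q : Fin (k + 1) → Fin n) (col : Fin (k + 1) → Fin 3), (∀ i, p i ≠ q i) ∧ (∀ i, (μ (col i) (p i) = p (i + 1) ∧ μ (col i) (q i) = q (i + 1)) ∨ (μ (col i) (p i) = q (i + 1) ∧ μ (col i) (q i) = p (i + 1))) ∧ (∀ i, col i ≠ col (i + 1)) ∧ (∀ i j, (p i = p j ∧ q i = q j) ∨ (p i = q j ∧ q i = p j) ∨ (p i ≠ p j ∧ p i ≠ q j ∧ q i ≠ p j ∧ q i ≠ q j)) ∧ (∀ i, p i ∉ R ∧ q i ∉ R) ∧ ((k : ℝ) + 1) ≤ (n : ℝ) ^ ((1 : ℝ) / 4)) := by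
  intro hAtom hGood
  obtain ⟨n₀, hn₀⟩ := hAtom
  refine ⟨n₀, fun n hn μ hμ R hR hpoor hrigid => ?_⟩
  rcases hn₀ n hn μ hμ R hR hpoor hrigid with hconcl | ⟨F, a, v, x, hRF, hvx, ha, hlt⟩
  · exact hconcl
  · dsimp only at hlt
    obtain ⟨β, hβ, β', hβ', hne, hcv, hcx, hnotB⟩ := exists_collision_not_mem _
      (List.foldl (fun w d => μ d w) v) (List.foldl (fun w d => μ d w) x) _ hlt
    have hclean : ∀ s ≤ a, ∀ t ≤ a, ((((β.take s).foldl (fun w d => μ d w) v) = ((β'.take t).foldl (fun w d => μ d w) v) ∧ ((β.take s).foldl (fun w d => μ d w) x) = ((β'.take t).foldl (fun w d => μ d w) x)) ∨ (((β.take s).foldl (fun w d => μ d w) v) = ((β'.take t).foldl (fun w d => μ d w) x) ∧ ((β.take s).foldl (fun w d => μ d w) x) = ((β'.take t).foldl (fun w d => μ d w) v)) ∨ (((β.take s).foldl (fun w d => μ d w) v) ≠ ((β'.take t).foldl (fun w d => μ d w) v) ∧ ((β.take s).foldl (fun w d => μ d w) v) ≠ ((β'.take t).foldl (fun w d => μ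 d w) x) ∧ ((β.take s).foldl (fun w d => μ d w) x) ≠ ((β'.take t).foldl (fun w d => μ d w) v) ∧ ((β.take s).foldl (fun w d => μ d w) x) ≠ ((β'.take t).foldl (fun w d => μ d w) x))) := by
      by_contra hc
      exact hnotB (mem_filter.2 ⟨mem_product.2 ⟨hβ, hβ'⟩, hne, hcv, hcx, hc⟩)
    simp only [mem_filter, mem_image, mem_univ, true_and] at hβ hβ'
    obtain ⟨⟨w, hw⟩, hch, hF, hself⟩ := hβ
    obtain ⟨⟨w', hw'⟩, hch', hF', hself'⟩ := hβ'
    have hlen : β.length = a := by rw [← hw]; exact w.toList_length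
    have hlen' : β'.length = a := by rw [← hw']; exact w'.toList_length
    have hμ1 : ∀ b, μ b * μ b = 1 := fun b => (hμ b).1
    have hRfree : ∀ t ≤ a, (β.take t).foldl (fun v b => μ b v) v ∉ R ∧ (β.take t).foldl (fun v b => μ b v) x ∉ R ∧
        (β'.take t).foldl (fun v b => μ b v) v ∉ R ∧ (β'.take t).foldl (fun v b => μ b v) x ∉ R := fun t ht =>
      ⟨fun h => (hF t ht).1 (hRF h), fun h => (hF t ht).2 (hRF h), fun h => (hF' t ht).1 (hRF h),
        fun h => (hF' t ht).2 (hRF h)⟩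
    obtain ⟨k, p, q, col, h1, h2, h3, h4, h5, hk⟩ := hGood n a μ R v x β β' hμ1 hvx hlen hlen' hne hch hch' hcv hcx
      hRfree (by
        rintro γ γ' (rfl | rfl) (rfl | rfl) s hs t ht
        · exact hself s hs t ht
        · exact hclean s hs t ht
        · rcases hclean t ht s hs with ⟨e1, e2⟩ | ⟨e1, e2⟩ | ⟨e1, e2, e3, e4⟩
          · exact Or.inl ⟨e1.symm, e2.symm⟩
          · exact Or.inr (Or.inl ⟨e2.symm, e1.symm⟩)
          · exact Or.inr (Or.inr ⟨e1.symm, e3.symm, e2.symm, e4.symm⟩)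
        · exact hself' s hs t ht)
    refine ⟨k, p, q, col, h1, h2, h3, h4, h5, ?_⟩
    have hk' : k + 1 ≤ ⌊(n : ℝ) ^ ((1 : ℝ) / 4)⌋₊ := hk.trans ha
    have hfl := Nat.floor_le (Real.rpow_nonneg (Nat.cast_nonneg n) ((1 : ℝ) / 4))
    calc (k : ℝ) + 1 = ((k + 1 : ℕ) : ℝ) := by push_cast; ring
      _ ≤ (⌊(n : ℝ) ^ ((1 : ℝ) / 4)⌋₊ : ℝ) := by exact_mod_cast hk'
      _ ≤ (n : ℝ) ^ ((1 : ℝ) / 4) := hfl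

end Summit.MatrixMultiplication.MatrixMultiplication.Theorems.HyperoctahedralThreshold
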